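import Literature.AnabelianGeometry.EtaleTheta.LogDivisorModelTateTowerKummerTwistInflate
import Literature.AnabelianGeometry.EtaleTheta.LogDivisorModelTateTowerKummerTwistLevelAction

/-!
# [EtTh] Def. 3.3 (ii)/(iii) v2: the level-`n` projection `(K ⋊_χ C) × ℤ_γ → (μ_{M_n} ⋊ Aut μ_{M_n}) × ℤ_γ` of the ζ-twisted
# Kummer–Tate group onto abc-iut-L2-d2's finite-level twist group

S. Mochizuki, *The étale theta function …*, Publ. RIMS **45** (2009) [MochizukiEtTh2009], §1 p.13, §3 Def. 3.3 (ii)–(iii) p.73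
[cite: MochizukiEtTh2009, Def 3.3 (iii) p.73].

CLASS (b) DESIGN MODEL, plumbing between abc-iut-L1-t6's group `TateTowerKummerTwist.Grp` (p471292) / `Compat` (p472997) and
abc-iut-L2-d2's per-level action `LogDivisorModel.TateTowerTwist.actionOf ρ` over `Twist A := (A ⋊ Aut A) × ℤ_γ`
(`LogDivisorModelTateTowerKummerTwistLevelAction.lean`), for piece (d) of row R677/R689/R722 (abc-iut cell, layer L2):
* **`toTwist n : Grp →* Twist (Multiplicative (ZMod (M n)))`** — `((k, c), γ) ↦ ((ζ^{(k_n).2}, χ_n(c)), γ)`: the `U`-root Kummer class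
  at level `n`, the cyclotomic character `zmodChar (M n) (c n)`, the translation; a homomorphism BECAUSE both semidirect products twist by
  multiplication (`toAdd_left_mul` of p472997 vs `zmodChar_apply`);
* `toTwistC n : Compat →* Twist (Multiplicative (ZMod (M n)))` — its restriction to the compatible group (the `ρ_n ∘ compat.subtype`
  of L2-d2's HANDOFF spec), so that level `n` of the tower is `actionOf (toTwistC n)`;
* `toTwist_eq_one_of_mem_closure` — `Δ_m` (`m > n`) maps to `1`: the input of the tower laws `act_closure_fn / act_closure_div`.
HONEST LABEL: design-model plumbing; nothing here bears on [IUTchIII] Cor. 3.12; no side taken; typed ≠ proved.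
-/

noncomputable section

namespace Literature.AnabelianGeometry.EtaleTheta

namespace TateTowerKummerTwist

open Function LogDivisorModel LogDivisorModel.TateTowerTwist

/-- The semidirect component of the level-`n` projection: `(k, c) ↦ (ζ^{(k_n).2}, χ_n(c))`.
[cite: MochizukiEtTh2009, Def 3.3 (ii) p.73] -/
def toTwistKC (n : ℕ) :
    KC →* (Multiplicative (ZMod (M n)) ⋊[MonoidHom.id (MulAut (Multiplicative (ZMod (M n))))]
      MulAut (Multiplicative (ZMod (M n)))) where
  toFun g := ⟨Multiplicative.ofAdd (g.left.toAdd n).2, zmodChar (M n) (g.right n)⟩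
  map_one' := by
    refine SemidirectProduct.ext ?_ ?_
    · change Multiplicative.ofAdd (((1 : KC).left.toAdd n).2) = 1
      rw [SemidirectProduct.one_left, toAdd_one, Pi.zero_apply, Prod.snd_zero, ofAdd_zero]
    · change zmodChar (M n) ((1 : KC).right n) = 1
      rw [SemidirectProduct.one_right, Pi.one_apply, map_one]
  map_mul' g h := by
    refine SemidirectProduct.ext ?_ ?_
    · change Multiplicative.ofAdd (((g * h).left.toAdd n).2) =
        Multiplicative.ofAdd ((g.left.toAdd n).2) *
          (MonoidHom.id _ (zmodChar (M n) (g.right n))) (Multiplicative.ofAdd ((h.left.toAdd n).2))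
      rw [MonoidHom.id_apply, zmodChar_apply, ← ofAdd_add, SemidirectProduct.mul_left, toAdd_mul, Pi.add_apply, Prod.snd_add,
        toAdd_act_apply]
      rfl
    · change zmodChar (M n) ((g * h).right n) = zmodChar (M n) (g.right n) * zmodChar (M n) (h.right n)
      rw [SemidirectProduct.mul_right, Pi.mul_apply, map_mul]

/-- **The level-`n` projection `(K ⋊_χ C) × ℤ_γ →* (μ_{M_n} ⋊ Aut μ_{M_n}) × ℤ_γ`.** [cite: MochizukiEtTh2009, Def 3.3 (iii) p.73] -/
def toTwist (n : ℕ) : Grp →* Twist (Multiplicative (ZMod (M n))) := (toTwistKC n).prodMap (MonoidHom.id _)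

/-- `toTwist` on the Kummer coordinate. [cite: MochizukiEtTh2009, Def 3.3 (ii) p.73] -/
@[simp] theorem toTwist_fst_left (n : ℕ) (g : Grp) : (toTwist n g).1.left = Multiplicative.ofAdd (g.1.left.toAdd n).2 := rfl

/-- `toTwist` on the constant-field coordinate: the cyclotomic character mod `M_n`. [cite: MochizukiEtTh2009, §1 p.13] -/
@[simp] theorem toTwist_fst_right (n : ℕ) (g : Grp) : (toTwist n g).1.right = zmodChar (M n) (g.1.right n) := rfl

/-- `toTwist` on the translation. [cite: MochizukiEtTh2009, Def 3.3 (iii) p.73] -/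
@[simp] theorem toTwist_snd (n : ℕ) (g : Grp) : (toTwist n g).2 = g.2 := rfl

/-- **`Δ_m` dies at every level `n < m`**: `toTwist n g = 1` for `g ∈ closure m`, `n < m` (the input of `act_closure_fn/div` for the
tower: `Δ_m` acts trivially on the functions and log-divisors of level `n`). [cite: MochizukiEtTh2009, Def 3.3 (iii) p.73] -/
theorem toTwist_eq_one_of_mem_closure {n m : ℕ} (hnm : n < m) {g : Grp} (hg : g ∈ closure m) : toTwist n g = 1 := by
  obtain ⟨h2, h1, h0⟩ := hg
  refine Prod.ext (SemidirectProduct.ext ?_ ?_) h2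
  · rw [toTwist_fst_left, h0 n hnm, Prod.snd_zero, ofAdd_zero]; rfl
  · rw [toTwist_fst_right, h1, Pi.one_apply, map_one]; rfl

/-- The level-`n` projection restricted to the COMPATIBLE group — the `ρ_n` of the tower's level-`n` action
`actionOf (toTwistC n)`. [cite: MochizukiEtTh2009, Def 3.3 (iii) p.73] -/
def toTwistC (n : ℕ) : Compat →* Twist (Multiplicative (ZMod (M n))) := (toTwist n).comp compat.subtype

/-- `toTwistC` is `toTwist` on the underlying element. [cite: MochizukiEtTh2009, Def 3.3 (iii) p.73] -/
@[simp] theorem toTwistC_apply (n : ℕ) (g : Compat) : toTwistC n g = toTwist n (g : Grp) := rfl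

/-- `closureC m` dies at every level `n < m`. [cite: MochizukiEtTh2009, Def 3.3 (iii) p.73] -/
theorem toTwistC_eq_one_of_mem_closureC {n m : ℕ} (hnm : n < m) {g : Compat} (hg : g ∈ closureC m) : toTwistC n g = 1 :=
  toTwist_eq_one_of_mem_closure hnm ((mem_closureC_iff m g).1 hg)

/-- The character components of `toTwistC` at two levels `i ≤ j` are COMPATIBLE (restriction of `χ_j(g)` is `χ_i(g)`), the
hypothesis of `inflate_smul_of_res_eq` — so the μ-transition `inflate` intertwines the two level actions on roots of unity.
[cite: MochizukiEtTh2009, §1 p.13] -/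
theorem res_toTwistC_char {i j : ℕ} (h : i ≤ j) (g : Compat) :
    res h ((g : Grp).1.right j : ZMod (M j)) = ((g : Grp).1.right i : ZMod (M i)) := by
  have hc := congrArg Units.val (g.2.2 i j h)
  rw [Units.coe_map] at hc
  exact hc

end TateTowerKummerTwist

end Literature.AnabelianGeometry.EtaleTheta

end
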